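import Literature.Probability.RandomPlanarGeometry.SLESwallowedRealPoints
import HarnessLib

/-!
# The same-side two-point problem: the energy identity and the level-hitting bound

Trunk T-STOCH. Stochastic layer of the **sharp** same-side two-point law of the real SLE_κ flow,
`4 < κ < 8`, `0 < y < x` (S. Rohde, O. Schramm, *Basic properties of SLE*, Ann. of Math. 161
(2005), Lemma 6.6 and its proof, p. 908: "the local martingale … optional sampling"):
`P[T_y = T_x] = (h(z₀) - h(1+))/(h(∞) - h(1+))`, `h = sameSideH (2/κ)`, `z₀ = x/(x-y)`. The tree
has the lower bound (`measureReal_swallowingTime_eq_ge`, `SLESwallowedRealPoints`); the upper bound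
needs to know that on `{T_y = T_x}` Lawler's ratio `Z = X/(X-Y)` reaches every level `1 + R`
before `T_y`. This file provides the two expectation computations behind that, both read off the
stopped martingales of `SLESameSideMartingale` (stopping rule `ρ`: `Y` leaves `(δ₁, R₁)` or `Z`
leaves `(1 + δ₀, 1 + R)`):

* `measureReal_sameSide_hit_le` — **the level-hitting bound**: for any lower bound `A` of `h` on
  `(1, ∞)`, `(h(1+R) - A) · P[Z_{N∧ρ} = 1 + R] ≤ h(z₀) - A` (constancy of `E h(Z_{t∧ρ})`,
  `martingale_apply_sameSideRatio_stopped`);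
* `integral_sameSide_energy_le` — **the energy identity, as a bound**: applying the Itô formula
  with drift kept (`martingale_apply_sameSideRatio_sub_timeIntegral`) to the *square* `f²` of a
  `C²` extension `f` of `h`: since the drift of `f` vanishes (`sameSideItoDrift_eq_zero`), the drift
  of `f²` is the carré du champ `κ K(Z)²/(X-Y)²` (`sameSideItoDrift_sq`), so
  `E ∫₀^{N∧ρ} κ K(Z_s)²/(X_s-Y_s)² ds = E h(Z_{N∧ρ})² - h(z₀)² ≤ (max(|A|,|M|))²` for bounds
  `A ≤ h ≤ M` on `(1, ∞)` — uniformly in all the levels and in `N`;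
* pathwise preliminaries for every `κ`: the logarithm of the gap
  `log(X_t - Y_t) = log(x-y) - ∫₀ᵗ 2/(X_s Y_s) ds` (`log_sleRealFlowStop_gap_eq`, the proof of
  `log_gap_eq` of `SLEKappaFourAvoidance` verbatim for general `κ`), hence `X_t - Y_t ≤ x - y`
  (`sleRealFlowStop_gap_le`) and `Z_t - 1 = Y_t/(X_t - Y_t) ≥ Y_t/(x - y)`
  (`div_le_sameSideRatio_sub_one`: while `Y ≥ δ₁` the ratio stays above `1 + δ₁/(x-y)`, so the
  lower `Z`-level never fires first once `δ₀ < δ₁/(x-y)`).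

## References

* S. Rohde, O. Schramm, *Basic properties of SLE*, Ann. of Math. 161 (2005), Lemma 6.6 and its
  proof (p. 908).
* G. F. Lawler, *Conformally Invariant Processes in the Plane*, AMS (2005), §6.7, Prop. 6.34.
* D. Revuz, M. Yor, *Continuous Martingales and Brownian Motion* (1999), Ch. IV (3.3).
-/

noncomputable section

open MeasureTheory ProbabilityTheory Filter Set Topology
open scoped NNReal ENNReal

namespace Literature.Probability.RandomPlanarGeometry

open Loewner Literature.Probability.Process Literature.Analysis.FunctionSpaces
  Literature.Analysis.Calculus

variable {κ : ℝ≥0} {x y : ℝ}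

/-! ### The gap of the two flows, general `κ` -/

/-- **The logarithm of the gap** (every `κ`): for `0 < y < x` and `t < T_y`,
`log(X_t - Y_t) = log(x - y) - ∫₀ᵗ 2/(X_s Y_s) ds` (the gap solves `D' = 2/X - 2/Y = -2D/(XY)`;
the proof of `log_gap_eq` for general `κ`). [folklore] -/
theorem log_sleRealFlowStop_gap_eq (hy : 0 < y) (hyx : y < x) {ω : ℝ≥0 → ℝ} {t : ℝ≥0}
    (ht : (t : WithTop ℝ≥0) < swallowingTime (sleDriving κ ω) y) :
    Real.log (sleRealFlowStop κ x t ω - sleRealFlowStop κ y t ω) =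
      Real.log (x - y) - ∫ s in (0 : ℝ)..t,
        2 / (sleRealFlowStop κ x s.toNNReal ω * sleRealFlowStop κ y s.toNNReal ω) := by
  have hx : 0 < x := hy.trans hyx
  set X : ℝ → ℝ := fun r ↦ sleRealFlowStop κ x r.toNNReal ω with hX
  set Y : ℝ → ℝ := fun r ↦ sleRealFlowStop κ y r.toNNReal ω with hY
  have hXc : Continuous X := (continuous_sleRealFlowStop hx.ne' ω).comp continuous_real_toNNReal
  have hYc : Continuous Y := (continuous_sleRealFlowStop hy.ne' ω).comp continuous_real_toNNReal
  -- facts along `[0, t]`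
  have hfacts : ∀ r ∈ Icc (0 : ℝ) t, 0 < Y r ∧ Y r < X r ∧
      X r - Y r = (x - y) + ∫ s in (0 : ℝ)..r, (2 / X s - 2 / Y s) := by
    intro r hr
    have hrt : ((r.toNNReal : ℝ≥0) : WithTop ℝ≥0) < swallowingTime (sleDriving κ ω) y :=
      lt_of_le_of_lt (WithTop.coe_le_coe.2 (Real.toNNReal_le_iff_le_coe.2 hr.2)) ht
    have h := sleRealFlowStop_sameSide_facts (κ := κ) hy hyx hrt
    simp only [hX, hY, Real.coe_toNNReal _ hr.1] at h ⊢
    exact h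
  -- the global integrand `g = 2/X - 2/Y` and the gap `D = (x - y) + ∫ g`
  set g : ℝ → ℝ := fun s ↦ 2 / X s - 2 / Y s with hg
  have hgm : Measurable g := (measurable_const.div hXc.measurable).sub (measurable_const.div hYc.measurable)
  have hgc : ∀ r ∈ Icc (0 : ℝ) t, ContinuousAt g r := fun r hr ↦
    (continuousAt_const.div hXc.continuousAt ((hfacts r hr).1.trans (hfacts r hr).2.1).ne').sub
      (continuousAt_const.div hYc.continuousAt (hfacts r hr).1.ne')
  have hgco : ContinuousOn g (Icc 0 t) := fun r hr ↦ (hgc r hr).continuousWithinAt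
  set D : ℝ → ℝ := fun r ↦ (x - y) + ∫ s in (0 : ℝ)..r, g s with hD
  have hDeq : ∀ r ∈ Icc (0 : ℝ) t, X r - Y r = D r := fun r hr ↦ (hfacts r hr).2.2
  have hDpos : ∀ r ∈ Icc (0 : ℝ) t, 0 < D r := fun r hr ↦ by
    rw [← hDeq r hr]; linarith [(hfacts r hr).2.1]
  have hDderiv : ∀ r ∈ Icc (0 : ℝ) t, HasDerivAt D (g r) r := by
    intro r hr
    have hint : IntervalIntegrable g volume 0 r :=
      (hgco.mono (by rw [uIcc_of_le hr.1]; exact Icc_subset_Icc_right hr.2)).intervalIntegrable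
    exact (intervalIntegral.integral_hasDerivAt_right hint
      hgm.aestronglyMeasurable.stronglyMeasurableAtFilter (hgc r hr)).const_add (x - y)
  -- `log D` has derivative `-2/(XY)` on `[0, t]`
  have hlogderiv : ∀ r ∈ Icc (0 : ℝ) t, HasDerivAt (fun r ↦ Real.log (D r)) (-(2 / (X r * Y r))) r := by
    intro r hr
    have h := (hDderiv r hr).log (hDpos r hr).ne'
    refine h.congr_deriv ?_
    rw [← hDeq r hr]
    obtain ⟨hYp, hYX, -⟩ := hfacts r hr
    have hXp : 0 < X r := hYp.trans hYX
    have hdne : X r - Y r ≠ 0 := by linarith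
    simp only [hg]
    field_simp
    ring
  have hrate_c : ContinuousOn (fun r ↦ -(2 / (X r * Y r))) (Icc 0 t) := fun r hr ↦
    (continuousAt_const.div (hXc.continuousAt.mul hYc.continuousAt)
      (mul_ne_zero ((hfacts r hr).1.trans (hfacts r hr).2.1).ne' (hfacts r hr).1.ne')).neg.continuousWithinAt
  have hFTC := intervalIntegral.integral_eq_sub_of_hasDerivAt
    (f := fun r ↦ Real.log (D r)) (f' := fun r ↦ -(2 / (X r * Y r)))
    (fun r hr ↦ hlogderiv r (by rwa [uIcc_of_le t.coe_nonneg] at hr))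
    (hrate_c.intervalIntegrable_of_Icc t.coe_nonneg)
  -- assemble
  have hD0 : D 0 = x - y := by simp [hD]
  have hDt : Real.log (D t) = Real.log (X t - Y t) := by rw [hDeq t ⟨t.coe_nonneg, le_rfl⟩]
  have hXt : X t = sleRealFlowStop κ x t ω := by simp [hX]
  have hYt : Y t = sleRealFlowStop κ y t ω := by simp [hY]
  simp only [intervalIntegral.integral_neg, hDt, hD0, hXt, hYt] at hFTC
  have hXY : ∀ s : ℝ, X s * Y s = sleRealFlowStop κ x s.toNNReal ω * sleRealFlowStop κ y s.toNNReal ω :=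
    fun s ↦ rfl
  simp only [hXY] at hFTC
  linarith

/-- **The integral `∫₀ᵗ 2/(X_s Y_s) ds` is non-negative** for `t < T_y` (positive integrand).
[folklore] -/
theorem integral_two_div_sleRealFlowStop_mul_nonneg (hy : 0 < y) (hyx : y < x) {ω : ℝ≥0 → ℝ} {t : ℝ≥0}
    (ht : (t : WithTop ℝ≥0) < swallowingTime (sleDriving κ ω) y) :
    0 ≤ ∫ s in (0 : ℝ)..t,
        2 / (sleRealFlowStop κ x s.toNNReal ω * sleRealFlowStop κ y s.toNNReal ω) := by
  refine intervalIntegral.integral_nonneg t.coe_nonneg fun s hs ↦ ?_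
  have hst : ((s.toNNReal : ℝ≥0) : WithTop ℝ≥0) < swallowingTime (sleDriving κ ω) y :=
    lt_of_le_of_lt (WithTop.coe_le_coe.2 (Real.toNNReal_le_iff_le_coe.2 hs.2)) ht
  obtain ⟨hY, hYX, -⟩ := sleRealFlowStop_sameSide_facts (κ := κ) hy hyx hst
  exact div_nonneg zero_le_two (mul_pos (hY.trans hYX) hY).le

/-- **The gap decreases: `X_t - Y_t ≤ x - y`** for `0 < y < x` and `t < T_y`. [folklore] -/
theorem sleRealFlowStop_gap_le (hy : 0 < y) (hyx : y < x) {ω : ℝ≥0 → ℝ} {t : ℝ≥0}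
    (ht : (t : WithTop ℝ≥0) < swallowingTime (sleDriving κ ω) y) :
    sleRealFlowStop κ x t ω - sleRealFlowStop κ y t ω ≤ x - y := by
  have hxy : 0 < x - y := by linarith
  have hlog := log_sleRealFlowStop_gap_eq hy hyx ht
  have hint := integral_two_div_sleRealFlowStop_mul_nonneg (κ := κ) hy hyx ht
  obtain ⟨-, hYX, -⟩ := sleRealFlowStop_sameSide_facts (κ := κ) hy hyx ht
  have hpos : 0 < sleRealFlowStop κ x t ω - sleRealFlowStop κ y t ω := sub_pos.2 hYX
  calc sleRealFlowStop κ x t ω - sleRealFlowStop κ y t ω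
        = Real.exp (Real.log (sleRealFlowStop κ x t ω - sleRealFlowStop κ y t ω)) := (Real.exp_log hpos).symm
    _ ≤ Real.exp (Real.log (x - y)) := Real.exp_le_exp.2 (by linarith)
    _ = x - y := Real.exp_log hxy

/-- **The ratio stays above `1 + Y/(x-y)`**: for `0 < y < x` and `t < T_y`,
`Y_t/(x - y) ≤ X_t/(X_t - Y_t) - 1 (= Y_t/(X_t - Y_t))`. [folklore] -/
theorem div_le_sameSideRatio_sub_one (hy : 0 < y) (hyx : y < x) {ω : ℝ≥0 → ℝ} {t : ℝ≥0}
    (ht : (t : WithTop ℝ≥0) < swallowingTime (sleDriving κ ω) y) :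
    sleRealFlowStop κ y t ω / (x - y) ≤
      sleRealFlowStop κ x t ω / (sleRealFlowStop κ x t ω - sleRealFlowStop κ y t ω) - 1 := by
  obtain ⟨hY, hYX, -⟩ := sleRealFlowStop_sameSide_facts (κ := κ) hy hyx ht
  have hgap := sleRealFlowStop_gap_le (κ := κ) hy hyx ht
  have hD : 0 < sleRealFlowStop κ x t ω - sleRealFlowStop κ y t ω := sub_pos.2 hYX
  have heq : sleRealFlowStop κ x t ω / (sleRealFlowStop κ x t ω - sleRealFlowStop κ y t ω) - 1 =
      sleRealFlowStop κ y t ω / (sleRealFlowStop κ x t ω - sleRealFlowStop κ y t ω) := by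
    field_simp; ring
  rw [heq]
  exact div_le_div_of_nonneg_left hY.le hD hgap

/-! ### The Itô drift of the square -/

/-- **The drift of `f²` is the carré du champ when the drift of `f` vanishes**: if `f ∈ C²(ℝ)`
has Lawler's derivatives `f' = K`, `f'' = K(-2a/z + 2a/(1-z))`, `a = 2/κ`, at `z = v/(v-u)`
(`0 < u < v`), then `𝓛(f²)(v, u) = κ K(z)²/(v-u)²` (`𝓛(f²) = 2f 𝓛f + σ_Z² (f')²`,
`σ_Z = -√κ/(v-u)`, and `𝓛f = 0` by `sameSideItoDrift_eq_zero`).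
[cite: RevuzYor1999, Ch. IV (3.3)] -/
theorem sameSideItoDrift_sq (hκ : 0 < κ) {f K : ℝ → ℝ} (hf : ContDiff ℝ 2 f) {v u : ℝ}
    (hu : 0 < u) (huv : u < v)
    (hf1 : deriv f (v / (v - u)) = K (v / (v - u)))
    (hf2 : iteratedDeriv 2 f (v / (v - u)) =
      K (v / (v - u)) * (-(2 * (2 / (κ : ℝ))) / (v / (v - u)) + 2 * (2 / (κ : ℝ)) / (1 - v / (v - u)))) :
    sameSideItoDrift κ (fun z ↦ f z ^ 2) v u = (κ : ℝ) * K (v / (v - u)) ^ 2 / (v - u) ^ 2 := by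
  have hdf : ∀ w, HasDerivAt f (deriv f w) w := fun w ↦
    ((hf.differentiable (by norm_num)).differentiableAt).hasDerivAt
  have hg1 : deriv (fun w ↦ f w ^ 2) = fun w ↦ 2 * f w * deriv f w := by
    funext w
    have h2 : HasDerivAt (fun w ↦ f w ^ 2) (deriv f w * f w + f w * deriv f w) w := by
      have := (hdf w).fun_mul (hdf w)
      simpa only [← sq] using this
    rw [h2.deriv]
    ring
  have hddf : HasDerivAt (deriv f) (iteratedDeriv 2 f (v / (v - u))) (v / (v - u)) := by
    have hd : Differentiable ℝ (iteratedDeriv 1 f) :=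
      hf.differentiable_iteratedDeriv 1 (by norm_num)
    rw [iteratedDeriv_one] at hd
    rw [iteratedDeriv_succ, iteratedDeriv_one]
    exact hd.differentiableAt.hasDerivAt
  have hg2 : iteratedDeriv 2 (fun w ↦ f w ^ 2) (v / (v - u)) =
      2 * deriv f (v / (v - u)) ^ 2 + 2 * f (v / (v - u)) * iteratedDeriv 2 f (v / (v - u)) := by
    rw [iteratedDeriv_succ, iteratedDeriv_one, hg1]
    have h := ((hdf (v / (v - u))).const_mul 2).fun_mul hddf
    rw [h.deriv]
    ring
  have h0 := sameSideItoDrift_eq_zero hκ hu huv hf1 hf2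
  simp only [sameSideItoDrift] at h0
  simp only [sameSideItoDrift, hg1, hg2]
  rw [hf1, hf2] at h0 ⊢
  linear_combination (2 * f (v / (v - u))) * h0

/-! ### The two expectation bounds -/

section Expectations

variable (hy : 0 < y) (hyx : y < x) {δ₀ R δ₁ R₁ : ℝ} (hδ₀ : 0 < δ₀) (hz₀ : 1 + δ₀ < x / (x - y))
  (hz₀' : x / (x - y) < 1 + R) (hδ₁ : 0 < δ₁) (hδ₁y : δ₁ < y) (hyR₁ : y < R₁)
include hy hyx hδ₀ hz₀ hz₀' hδ₁ hδ₁y hyR₁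

/-- **The level-hitting bound.** For `4 < κ`, `h = sameSideH (2/κ)`, any lower bound `A` of `h` on
`(1, ∞)` and every time `N`: `(h(1+R) - A) · P[Z_{N∧ρ} = 1 + R] ≤ h(z₀) - A`, `z₀ = x/(x-y)`,
where `Z_{N∧ρ}` is the ratio of the flows stopped at the same-side stopping time (constancy of
`E h(Z_{t∧ρ})`, `martingale_apply_sameSideRatio_stopped`; `h(Z) ≥ A`, and `= h(1+R)` on the
event). [cite: RohdeSchramm2005, proof of Lemma 6.6] -/
theorem measureReal_sameSide_hit_le (hκ4 : 4 < κ) {A : ℝ}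
    (hA : ∀ z : ℝ, 1 < z → A ≤ sameSideH (2 / (κ : ℝ)) z) (N : ℝ≥0) :
    (sameSideH (2 / (κ : ℝ)) (1 + R) - A) *
        preWienerMeasure.real {ω |
          stoppedProcess (sleRealFlowStop κ x) (sleSameSideTime κ x y δ₀ R δ₁ R₁) N ω /
            (stoppedProcess (sleRealFlowStop κ x) (sleSameSideTime κ x y δ₀ R δ₁ R₁) N ω -
              stoppedProcess (sleRealFlowStop κ y) (sleSameSideTime κ x y δ₀ R δ₁ R₁) N ω) = 1 + R} ≤
      sameSideH (2 / (κ : ℝ)) (x / (x - y)) - A := by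
  haveI := isProbabilityMeasure_preWienerMeasure'
  have hx : 0 < x := hy.trans hyx
  have hκ0 : 0 < κ := lt_trans (by norm_num) hκ4
  set a : ℝ := 2 / (κ : ℝ) with ha
  set h := sameSideH a with hh
  have hz1 : 1 < 1 + δ₀ := by linarith
  -- a `C²` function equal to `h` near `[1+δ₀, 1+R]`
  obtain ⟨f, hf, hfeq, -⟩ := exists_contDiff_eqOn_Icc (n := 2) (a := 1) (b := R + 3) (lo := 1 + δ₀ / 2)
    (hi := R + 2) (by linarith) (by linarith [hz₀.trans hz₀']) (by linarith)
    ((contDiffOn_two_sameSideH a).mono fun z hz ↦ (show (1 : ℝ) < z from hz.1))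
  have hfnhds : ∀ z ∈ Icc (1 + δ₀) (1 + R), f =ᶠ[𝓝 z] h := by
    intro z hz
    have hmem : Ioo (1 + δ₀ / 2) (R + 2) ∈ 𝓝 z := Ioo_mem_nhds (by linarith [hz.1]) (by linarith [hz.2])
    filter_upwards [hmem] with u hu
    exact hfeq (Ioo_subset_Icc_self hu)
  have hzgt : ∀ z ∈ Icc (1 + δ₀) (1 + R), 1 < z := fun z hz ↦ lt_of_lt_of_le hz1 hz.1
  have hf1 : ∀ z ∈ Icc (1 + δ₀) (1 + R), deriv f z = sameSideKernel a z := by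
    intro z hz
    rw [(hfnhds z hz).deriv_eq]
    exact deriv_sameSideH a (hzgt z hz)
  have hf2 : ∀ z ∈ Icc (1 + δ₀) (1 + R),
      iteratedDeriv 2 f z = sameSideKernel a z * (-(2 * a) / z + 2 * a / (1 - z)) := by
    intro z hz
    rw [iteratedDeriv_succ, iteratedDeriv_one]
    have h1 : deriv f =ᶠ[𝓝 z] sameSideKernel a := by
      have hmem : Ioi (1 : ℝ) ∈ 𝓝 z := Ioi_mem_nhds (hzgt z hz)
      filter_upwards [(hfnhds z hz).deriv, hmem] with u hu hu'
      rw [hu]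
      exact deriv_sameSideH a hu'
    rw [h1.deriv_eq]
    exact (hasDerivAt_sameSideKernel a (hzgt z hz)).deriv
  have hmart := martingale_apply_sameSideRatio_stopped hκ0 hy hyx hδ₀ hz₀ hz₀' hδ₁ hδ₁y hyR₁ hf
    (K := sameSideKernel a) hf1 hf2
  set ρ := sleSameSideTime κ x y δ₀ R δ₁ R₁ with hρ
  set Zρ : ℝ≥0 → (ℝ≥0 → ℝ) → ℝ := fun t ω ↦ stoppedProcess (sleRealFlowStop κ x) ρ t ω /
    (stoppedProcess (sleRealFlowStop κ x) ρ t ω - stoppedProcess (sleRealFlowStop κ y) ρ t ω) with hZρ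
  -- the stopped ratio stays in `[1+δ₀, 1+R]`
  have hZmem : ∀ t ω, Zρ t ω ∈ Icc (1 + δ₀) (1 + R) := by
    intro t ω
    have h := (sleSameSide_bounds_of_le hy hyx hδ₀ hz₀ hz₀' hδ₁ hδ₁y hyR₁
      (coe_untopA_min_le t (ρ ω))).2.2.2.1
    simpa only [hZρ, stoppedProcess] using h
  have hO : ∀ t ω, f (Zρ t ω) = h (Zρ t ω) := fun t ω ↦ hfeq ⟨by linarith [(hZmem t ω).1], by linarith [(hZmem t ω).2]⟩
  -- expectation of the martingale
  have hE : ∫ ω, f (Zρ N ω) ∂preWienerMeasure = h (x / (x - y)) := by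
    have h1 := integral_eq_of_martingale hmart N
    rw [show (fun ω ↦ f (Zρ N ω)) = fun ω ↦ f (stoppedProcess (sleRealFlowStop κ x) ρ N ω /
      (stoppedProcess (sleRealFlowStop κ x) ρ N ω - stoppedProcess (sleRealFlowStop κ y) ρ N ω)) from rfl, h1]
    have h0 : ∀ ω, f (stoppedProcess (sleRealFlowStop κ x) ρ 0 ω /
        (stoppedProcess (sleRealFlowStop κ x) ρ 0 ω - stoppedProcess (sleRealFlowStop κ y) ρ 0 ω)) =
        h (x / (x - y)) := by
      intro ω
      have := hO 0 ω
      simp only [hZρ, stoppedProcess, untopA_min_zero, sleRealFlowStop_zero_apply hx.ne',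
        sleRealFlowStop_zero_apply hy.ne'] at this ⊢
      exact this
    simp only [h0, integral_const, smul_eq_mul, probReal_univ, one_mul]
  -- the event and the integral inequality
  set B : Set (ℝ≥0 → ℝ) := {ω | Zρ N ω = 1 + R} with hB
  have hBm : MeasurableSet B := by
    have hρst : IsStoppingTime brownianFiltration ρ :=
      isStoppingTime_sleSameSideTime (κ := κ) hy hyx hδ₁ hδ₁y hyR₁ δ₀ R
    have hmx : Measurable (stoppedProcess (sleRealFlowStop κ x) ρ N) :=
      (((isStronglyProgressive_sleRealFlowStop κ hx.ne').stronglyAdapted_stoppedProcess hρst) N).measurable.mono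
        (brownianFiltration.le N) le_rfl
    have hmy : Measurable (stoppedProcess (sleRealFlowStop κ y) ρ N) :=
      (((isStronglyProgressive_sleRealFlowStop κ hy.ne').stronglyAdapted_stoppedProcess hρst) N).measurable.mono
        (brownianFiltration.le N) le_rfl
    exact measurableSet_eq_fun (hmx.div (hmx.sub hmy)) measurable_const
  set Dn : ℝ := h (1 + R) - A with hDn
  have hpt : ∀ ω, Dn * B.indicator (fun _ ↦ (1 : ℝ)) ω ≤ f (Zρ N ω) - A := by
    intro ω
    rw [hO N ω]
    by_cases hω : ω ∈ B
    · rw [indicator_of_mem hω, mul_one]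
      have hωeq : Zρ N ω = 1 + R := hω
      rw [hωeq]
    · rw [indicator_of_notMem hω, mul_zero, sub_nonneg]
      exact hA _ (hzgt _ (hZmem N ω))
  have hint : Integrable (fun ω ↦ f (Zρ N ω)) preWienerMeasure := hmart.integrable N
  have h1 : ∫ ω, (f (Zρ N ω) - A) ∂preWienerMeasure = h (x / (x - y)) - A := by
    rw [integral_sub hint (integrable_const _), hE, integral_const, smul_eq_mul, probReal_univ, one_mul]
  have h2 : ∫ ω, Dn * B.indicator (fun _ ↦ (1 : ℝ)) ω ∂preWienerMeasure = Dn * preWienerMeasure.real B := by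
    rw [integral_const_mul, integral_indicator_const _ hBm, smul_eq_mul, mul_one]
  change Dn * preWienerMeasure.real B ≤ h (x / (x - y)) - A
  rw [← h1, ← h2]
  exact integral_mono ((integrable_const (1 : ℝ)).indicator hBm |>.const_mul Dn)
    (hint.sub (integrable_const _)) hpt

/-- **The energy identity, as a uniform bound.** For `4 < κ`, `h = sameSideH (2/κ)`,
`K = sameSideKernel (2/κ)`, bounds `A ≤ h ≤ M` on `(1, ∞)` and every time `N`, the stopped energy
`Φ_N = ∫₀^{N∧ρ} κ K(Z_s)²/(X_s - Y_s)² ds` (`Z = X/(X-Y)`, the carré du champ of `h(Z)`) is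
measurable, non-negative, integrable and `E Φ_N = E h(Z_{N∧ρ})² - h(z₀)² ≤ max(|A|, |M|)²`
(the Itô formula with drift for `f²`, `martingale_apply_sameSideRatio_sub_timeIntegral` and
`sameSideItoDrift_sq`). The bound does not depend on the levels `δ₀, R, δ₁, R₁` nor on `N`.
[cite: RohdeSchramm2005, proof of Lemma 6.6] -/
theorem integral_sameSide_energy_le (hκ4 : 4 < κ) {A M : ℝ}
    (hA : ∀ z : ℝ, 1 < z → A ≤ sameSideH (2 / (κ : ℝ)) z)
    (hM : ∀ z : ℝ, 1 < z → sameSideH (2 / (κ : ℝ)) z ≤ M) (N : ℝ≥0) :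
    let Φ : (ℝ≥0 → ℝ) → ℝ := fun ω ↦ timeIntegral (trunc (sleSameSideTime κ x y δ₀ R δ₁ R₁) fun s ω ↦
      (κ : ℝ) * sameSideKernel (2 / (κ : ℝ))
          (sleRealFlowStop κ x s ω / (sleRealFlowStop κ x s ω - sleRealFlowStop κ y s ω)) ^ 2 /
        (sleRealFlowStop κ x s ω - sleRealFlowStop κ y s ω) ^ 2) N ω
    Measurable Φ ∧ Integrable Φ preWienerMeasure ∧ (∀ ω, 0 ≤ Φ ω) ∧
      ∫ ω, Φ ω ∂preWienerMeasure ≤ (max |A| |M|) ^ 2 := by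
  intro Φ
  haveI := isProbabilityMeasure_preWienerMeasure'
  have hx : 0 < x := hy.trans hyx
  have hκ0 : 0 < κ := lt_trans (by norm_num) hκ4
  set a : ℝ := 2 / (κ : ℝ) with ha
  set h := sameSideH a with hh
  have hz1 : 1 < 1 + δ₀ := by linarith
  -- a `C²` function equal to `h` near `[1+δ₀, 1+R]`
  obtain ⟨f, hf, hfeq, -⟩ := exists_contDiff_eqOn_Icc (n := 2) (a := 1) (b := R + 3) (lo := 1 + δ₀ / 2)
    (hi := R + 2) (by linarith) (by linarith [hz₀.trans hz₀']) (by linarith)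
    ((contDiffOn_two_sameSideH a).mono fun z hz ↦ (show (1 : ℝ) < z from hz.1))
  have hfnhds : ∀ z ∈ Icc (1 + δ₀) (1 + R), f =ᶠ[𝓝 z] h := by
    intro z hz
    have hmem : Ioo (1 + δ₀ / 2) (R + 2) ∈ 𝓝 z := Ioo_mem_nhds (by linarith [hz.1]) (by linarith [hz.2])
    filter_upwards [hmem] with u hu
    exact hfeq (Ioo_subset_Icc_self hu)
  have hzgt : ∀ z ∈ Icc (1 + δ₀) (1 + R), 1 < z := fun z hz ↦ lt_of_lt_of_le hz1 hz.1
  have hf1 : ∀ z ∈ Icc (1 + δ₀) (1 + R), deriv f z = sameSideKernel a z := by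
    intro z hz
    rw [(hfnhds z hz).deriv_eq]
    exact deriv_sameSideH a (hzgt z hz)
  have hf2 : ∀ z ∈ Icc (1 + δ₀) (1 + R),
      iteratedDeriv 2 f z = sameSideKernel a z * (-(2 * a) / z + 2 * a / (1 - z)) := by
    intro z hz
    rw [iteratedDeriv_succ, iteratedDeriv_one]
    have h1 : deriv f =ᶠ[𝓝 z] sameSideKernel a := by
      have hmem : Ioi (1 : ℝ) ∈ 𝓝 z := Ioi_mem_nhds (hzgt z hz)
      filter_upwards [(hfnhds z hz).deriv, hmem] with u hu hu'
      rw [hu]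
      exact deriv_sameSideH a hu'
    rw [h1.deriv_eq]
    exact (hasDerivAt_sameSideKernel a (hzgt z hz)).deriv
  -- the Itô formula with drift for `f²`
  have hg : ContDiff ℝ 2 (fun z ↦ f z ^ 2) := hf.pow 2
  have hmart := martingale_apply_sameSideRatio_sub_timeIntegral hκ0 hy hyx hδ₀ hz₀ hz₀' hδ₁ hδ₁y hyR₁ hg
  set ρ := sleSameSideTime κ x y δ₀ R δ₁ R₁ with hρ
  set Zρ : ℝ≥0 → (ℝ≥0 → ℝ) → ℝ := fun t ω ↦ stoppedProcess (sleRealFlowStop κ x) ρ t ω /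
    (stoppedProcess (sleRealFlowStop κ x) ρ t ω - stoppedProcess (sleRealFlowStop κ y) ρ t ω) with hZρ
  have hbounds : ∀ (ω : ℝ≥0 → ℝ) (t : ℝ≥0), (t : WithTop ℝ≥0) ≤ ρ ω →
      δ₁ ≤ sleRealFlowStop κ y t ω ∧ sleRealFlowStop κ y t ω < sleRealFlowStop κ x t ω ∧
      sleRealFlowStop κ x t ω / (sleRealFlowStop κ x t ω - sleRealFlowStop κ y t ω) ∈ Icc (1 + δ₀) (1 + R) :=
    fun ω t ht ↦ by
      have h := sleSameSide_bounds_of_le (κ := κ) hy hyx hδ₀ hz₀ hz₀' hδ₁ hδ₁y hyR₁ ht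
      exact ⟨h.2.1, h.2.2.1, h.2.2.2.1⟩
  -- the drift of `f²` is the energy rate
  set I : ℝ≥0 → (ℝ≥0 → ℝ) → ℝ := fun s ω ↦ (κ : ℝ) * sameSideKernel a
      (sleRealFlowStop κ x s ω / (sleRealFlowStop κ x s ω - sleRealFlowStop κ y s ω)) ^ 2 /
    (sleRealFlowStop κ x s ω - sleRealFlowStop κ y s ω) ^ 2 with hI
  have hdrift : (trunc ρ fun s ω ↦ sameSideItoDrift κ (fun z ↦ f z ^ 2) (sleRealFlowStop κ x s ω)
      (sleRealFlowStop κ y s ω)) = trunc ρ I := by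
    funext s ω
    by_cases hs : (s : WithTop ℝ≥0) ≤ ρ ω
    · rw [trunc_of_le hs, trunc_of_le hs]
      obtain ⟨hY, hYX, hZ⟩ := hbounds ω s hs
      exact sameSideItoDrift_sq hκ0 hf (hδ₁.trans_le hY) hYX (hf1 _ hZ) (hf2 _ hZ)
    · rw [trunc_of_not_le hs, trunc_of_not_le hs]
  rw [hdrift] at hmart
  have hΦ : Φ = fun ω ↦ timeIntegral (trunc ρ I) N ω := rfl
  -- `hmart : Martingale (fun t ω ↦ f (Zρ t ω) ^ 2 - timeIntegral (trunc ρ I) t ω)`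
  have hZmem : ∀ t ω, Zρ t ω ∈ Icc (1 + δ₀) (1 + R) := by
    intro t ω
    have h := (hbounds ω _ (coe_untopA_min_le t (ρ ω))).2.2
    simpa only [hZρ, stoppedProcess] using h
  have hO : ∀ t ω, f (Zρ t ω) = h (Zρ t ω) := fun t ω ↦
    hfeq ⟨by linarith [(hZmem t ω).1], by linarith [(hZmem t ω).2]⟩
  set C : ℝ := max |A| |M| with hC
  have hfbd : ∀ t ω, |f (Zρ t ω)| ≤ C := fun t ω ↦ by
    rw [hO t ω]
    exact abs_le_max_abs_abs (hA _ (hzgt _ (hZmem t ω))) (hM _ (hzgt _ (hZmem t ω)))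
  have hsqbd : ∀ t ω, f (Zρ t ω) ^ 2 ≤ C ^ 2 := fun t ω ↦ by
    rw [← sq_abs]
    exact pow_le_pow_left₀ (abs_nonneg _) (hfbd t ω) 2
  -- measurability and integrability
  have hρst : IsStoppingTime brownianFiltration ρ :=
    isStoppingTime_sleSameSideTime (κ := κ) hy hyx hδ₁ hδ₁y hyR₁ δ₀ R
  have hZm : Measurable fun ω ↦ Zρ N ω := by
    have hmx : Measurable (stoppedProcess (sleRealFlowStop κ x) ρ N) :=
      (((isStronglyProgressive_sleRealFlowStop κ hx.ne').stronglyAdapted_stoppedProcess hρst) N).measurable.mono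
        (brownianFiltration.le N) le_rfl
    have hmy : Measurable (stoppedProcess (sleRealFlowStop κ y) ρ N) :=
      (((isStronglyProgressive_sleRealFlowStop κ hy.ne').stronglyAdapted_stoppedProcess hρst) N).measurable.mono
        (brownianFiltration.le N) le_rfl
    exact hmx.div (hmx.sub hmy)
  have hfm : Measurable fun ω ↦ f (Zρ N ω) ^ 2 :=
    (hf.continuous.measurable.comp hZm).pow_const 2
  have hfint : Integrable (fun ω ↦ f (Zρ N ω) ^ 2) preWienerMeasure :=
    Integrable.of_bound hfm.aestronglyMeasurable (C ^ 2) (ae_of_all _ fun ω ↦ by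
      rw [Real.norm_of_nonneg (sq_nonneg _)]; exact hsqbd N ω)
  have hMint : Integrable (fun ω ↦ f (Zρ N ω) ^ 2 - timeIntegral (trunc ρ I) N ω) preWienerMeasure :=
    hmart.integrable N
  have hMm : Measurable fun ω ↦ f (Zρ N ω) ^ 2 - timeIntegral (trunc ρ I) N ω :=
    ((hmart.stronglyAdapted N).mono (brownianFiltration.le N)).measurable
  have hΦeq : (fun ω ↦ timeIntegral (trunc ρ I) N ω) = fun ω ↦
      f (Zρ N ω) ^ 2 - (f (Zρ N ω) ^ 2 - timeIntegral (trunc ρ I) N ω) := by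
    funext ω; ring
  have hΦm : Measurable fun ω ↦ timeIntegral (trunc ρ I) N ω := by
    rw [hΦeq]; exact hfm.sub hMm
  have hΦint : Integrable (fun ω ↦ timeIntegral (trunc ρ I) N ω) preWienerMeasure := by
    rw [hΦeq]; exact hfint.sub hMint
  -- non-negativity
  have hΦnn : ∀ ω, 0 ≤ timeIntegral (trunc ρ I) N ω := by
    intro ω
    simp only [timeIntegral]
    refine intervalIntegral.integral_nonneg N.coe_nonneg fun s _ ↦ ?_
    by_cases hs : ((s.toNNReal : ℝ≥0) : WithTop ℝ≥0) ≤ ρ ω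
    · rw [trunc_of_le hs]
      obtain ⟨hY, hYX, hZ⟩ := hbounds ω _ hs
      simp only [hI]
      have hK : 0 < sameSideKernel a (sleRealFlowStop κ x s.toNNReal ω /
          (sleRealFlowStop κ x s.toNNReal ω - sleRealFlowStop κ y s.toNNReal ω)) :=
        sameSideKernel_pos a (hzgt _ hZ)
      positivity
    · rw [trunc_of_not_le hs]
  -- the expectation
  have hE : ∫ ω, (f (Zρ N ω) ^ 2 - timeIntegral (trunc ρ I) N ω) ∂preWienerMeasure =
      h (x / (x - y)) ^ 2 := by
    have h1 := integral_eq_of_martingale hmart N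
    have h0 : ∀ ω, f (stoppedProcess (sleRealFlowStop κ x) ρ 0 ω /
        (stoppedProcess (sleRealFlowStop κ x) ρ 0 ω - stoppedProcess (sleRealFlowStop κ y) ρ 0 ω)) ^ 2 -
        timeIntegral (trunc ρ I) 0 ω = h (x / (x - y)) ^ 2 := by
      intro ω
      have hz : x / (x - y) ∈ Icc (1 + δ₀) (1 + R) := ⟨hz₀.le, hz₀'.le⟩
      simp only [stoppedProcess, untopA_min_zero, sleRealFlowStop_zero_apply hx.ne',
        sleRealFlowStop_zero_apply hy.ne', timeIntegral_apply_zero, sub_zero]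
      rw [hfeq ⟨by linarith [hz.1], by linarith [hz.2]⟩]
    simp only [h0, integral_const, smul_eq_mul, probReal_univ, one_mul] at h1
    exact h1
  refine ⟨hΦm, hΦint, hΦnn, ?_⟩
  have h2 : ∫ ω, timeIntegral (trunc ρ I) N ω ∂preWienerMeasure =
      ∫ ω, f (Zρ N ω) ^ 2 ∂preWienerMeasure - h (x / (x - y)) ^ 2 := by
    rw [← hE, ← integral_sub hfint hMint]
    simp only [sub_sub_cancel]
  change ∫ ω, timeIntegral (trunc ρ I) N ω ∂preWienerMeasure ≤ C ^ 2
  rw [h2]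
  have h3 : ∫ ω, f (Zρ N ω) ^ 2 ∂preWienerMeasure ≤ C ^ 2 := by
    have := integral_mono hfint (integrable_const (C ^ 2)) fun ω ↦ hsqbd N ω
    simpa only [integral_const, smul_eq_mul, probReal_univ, one_mul] using this
  linarith [sq_nonneg (h (x / (x - y)))]

end Expectations

end Literature.Probability.RandomPlanarGeometry
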